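import Summits.Ventures.PercRepro.C025ProfileGirthHallSuccA

/-!
# THE HALL FORM OF THE ROW `(q, q+1)` AT GIRTH `≥ q + 1` — PART B0: SMALL LEMMAS AND THE APEX OF A LOADER (night-3 g18)

* `mem_Rq_of_card_eq`, `mem_Rq_of_subset`, `card_eq_of_mem_Rq_subset_succ` — which subsets are rank-`q` sets at girth `≥ q + 1`;
* **`subset_erase_apex_of_weight_ne_zero`** — for the weights of part B (described by the vanishing hypothesis `h0`), a loader `B`
  of a rank-`(q+1)` set `S` of `≥ q + 2` points with `W B S ≠ 0` lies below an apex `y` (`ρ(S ∖ y) = q`, `B ⊆ S ∖ y`): in each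
  of the four branches the extra point(s) inside the closure complete `B` to `S ∖ y`.
No `def`, no `instance`, no notation.  Axioms: standard.
-/

open scoped Matroid

namespace PercRepro

open Set Finset ThmH Staged

namespace GirthRows

variable {α : Type} [DecidableEq α] {M : Matroid α} [M.Finite]

open scoped Classical

omit [DecidableEq α] in
/-- Every `q`-subset of the ground set is a rank-`q` set (girth `≥ q + 1`). -/
theorem mem_Rq_of_card_eq {q : ℕ} (hg : ∀ T ⊆ M.E, T.encard ≤ q → M.Indep T) {B : Finset α} (hBg : B ⊆ gr M)
    (hBc : B.card = q) : B ∈ Profile.Rq M q := by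
  rw [Profile.mem_Rq]
  refine ⟨hBg, ?_⟩
  have hBE : (B : Set α) ⊆ M.E := by rw [← coe_gr]; exact_mod_cast hBg
  have hi : M.Indep (B : Set α) := hg _ hBE (by rw [Set.encard_coe_eq_coe_finsetCard, hBc])
  rw [hi.eRk_eq_encard, Set.encard_coe_eq_coe_finsetCard, hBc]

omit [DecidableEq α] in
/-- A subset of a rank-`q` set with at least `q` points is a rank-`q` set. -/
theorem mem_Rq_of_subset {q : ℕ} (hg : ∀ T ⊆ M.E, T.encard ≤ q → M.Indep T) {X B : Finset α} (hXg : X ⊆ gr M)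
    (hXr : rkN M X = q) (hBX : B ⊆ X) (hBc : q ≤ B.card) : B ∈ Profile.Rq M q := by
  rw [Profile.mem_Rq]
  refine ⟨hBX.trans hXg, ?_⟩
  rw [← Staged.coe_rkN]
  have h1 : rkN M B ≤ rkN M X := Staged.rkN_mono hBX
  obtain ⟨T, hTB, hTc⟩ := Finset.exists_subset_card_eq hBc
  have hT : T ∈ Profile.Rq M q := mem_Rq_of_card_eq hg (hTB.trans (hBX.trans hXg)) hTc
  have h2 : rkN M T ≤ rkN M B := Staged.rkN_mono hTB
  have h3 : rkN M T = q := Staged.rkN_eq_iff.2 (Profile.mem_Rq.1 hT).2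
  have : rkN M B = q := by omega
  rw [this]

omit [DecidableEq α] in
/-- A rank-`q` set inside a rank-`(q+1)` set of `q + 1` points has `q` points. -/
theorem card_eq_of_mem_Rq_subset_succ {q : ℕ} {S B : Finset α} (hSr : rkN M S = q + 1) (hSc : S.card = q + 1)
    (hB : B ∈ Profile.Rq M q) (hBS : B ⊆ S) : B.card = q := by
  have hBr : rkN M B = q := Staged.rkN_eq_iff.2 (Profile.mem_Rq.1 hB).2
  have h1 : rkN M B ≤ B.card := Staged.rkN_le_card B
  have h2 : B.card ≤ S.card := Finset.card_le_card hBS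
  rcases Nat.lt_or_ge B.card (q + 1) with hlt | hge
  · omega
  · exfalso
    have hBS' : B = S := Finset.eq_of_subset_of_card_le hBS (by omega)
    rw [hBS'] at hBr
    omega

/-- A loader of `S` with nonzero weight lies under an apex: if `W B S ≠ 0` (`W` vanishing outside the four branches) then
some `y ∈ S` has `ρ(S ∖ y) = q` and `B ⊆ S ∖ y`. -/
theorem subset_erase_apex_of_weight_ne_zero {q : ℕ} {S : Finset α} (hSg : S ⊆ gr M)
    (hk2 : q + 2 ≤ S.card) (W : Finset α → Finset α → ℚ)
    (h0 : ∀ B S : Finset α,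
      ¬ (B ⊆ S ∧ B.card = q ∧ S.card = q + 1) →
      ¬ (B ⊆ S ∧ B.card = q ∧ S.card = q + 2 ∧ ((S \ B).filter (fun x => x ∈ M.closure (B : Set α))).card = 1) →
      ¬ (B ⊆ S ∧ q + 1 ≤ B.card ∧ S.card = B.card + 1 ∧
          ((S \ B).filter (fun x => x ∈ M.closure (B : Set α))).card = 0) →
      ¬ (B ⊆ S ∧ B.card = q + 1 ∧ ((gr M).filter (fun x => x ∉ M.closure (B : Set α))).card = 2 ∧
          2 * q + 1 ≤ ((gr M).filter (fun x => x ∈ M.closure (B : Set α))).card ∧ S.card = q + 3 ∧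
          ((S \ B).filter (fun x => x ∈ M.closure (B : Set α))).card = 1) → W B S = 0)
    {B : Finset α} (hBq : B ∈ Profile.Rq M q) (hBS : B ⊆ S) (hW : W B S ≠ 0) :
    ∃ y ∈ S, rkN M (S.erase y) = q ∧ B ⊆ S.erase y := by
  have hBr : rkN M B = q := Staged.rkN_eq_iff.2 (Profile.mem_Rq.1 hBq).2
  have hBg : B ⊆ gr M := (Profile.mem_Rq.1 hBq).1
  by_contra hcon
  have hcon' : ∀ y ∈ S, rkN M (S.erase y) = q → ¬ B ⊆ S.erase y := fun y hy hr h => hcon ⟨y, hy, hr, h⟩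
  apply hW
  apply h0 B S
  · rintro ⟨_, _, hSc⟩; omega
  · rintro ⟨_, hBc, hSc, hcnt⟩
    obtain ⟨x, hx⟩ := Finset.card_eq_one.1 hcnt
    have hxm : x ∈ (S \ B).filter (fun x => x ∈ M.closure (B : Set α)) := by rw [hx]; exact Finset.mem_singleton_self x
    rw [Finset.mem_filter, Finset.mem_sdiff] at hxm
    have hxg : x ∈ gr M := hSg hxm.1.1
    have hCr : rkN M (insert x B) = q := by
      rw [(mem_closure_iff_rkN_insert hBg hxg).1 hxm.2, hBr]
    have hCc : (insert x B).card = q + 1 := by rw [Finset.card_insert_of_notMem hxm.1.2, hBc]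
    have hCS : insert x B ⊆ S := Finset.insert_subset hxm.1.1 hBS
    have hcard : (S \ insert x B).card = 1 := by rw [Finset.card_sdiff_of_subset hCS, hSc, hCc]; omega
    obtain ⟨y, hy⟩ := Finset.card_eq_one.1 hcard
    have hym : y ∈ S \ insert x B := by rw [hy]; exact Finset.mem_singleton_self y
    rw [Finset.mem_sdiff] at hym
    have hSeq : S.erase y = insert x B := by
      apply Finset.eq_of_subset_of_card_le
      · intro z hz
        rw [Finset.mem_erase] at hz
        by_contra hzC
        have : z ∈ S \ insert x B := Finset.mem_sdiff.2 ⟨hz.2, hzC⟩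
        rw [hy, Finset.mem_singleton] at this
        exact hz.1 this
      · rw [Finset.card_erase_of_mem hym.1, hSc, hCc]; omega
    apply hcon' y hym.1 (by rw [hSeq]; exact hCr)
    rw [hSeq]; exact Finset.subset_insert x B
  · rintro ⟨_, hBc, hSc, _⟩
    have hcard : (S \ B).card = 1 := by rw [Finset.card_sdiff_of_subset hBS, hSc]; omega
    obtain ⟨y, hy⟩ := Finset.card_eq_one.1 hcard
    have hym : y ∈ S \ B := by rw [hy]; exact Finset.mem_singleton_self y
    rw [Finset.mem_sdiff] at hym
    have hSeq : S.erase y = B := by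
      apply Finset.eq_of_subset_of_card_le
      · intro z hz
        rw [Finset.mem_erase] at hz
        by_contra hzB
        have : z ∈ S \ B := Finset.mem_sdiff.2 ⟨hz.2, hzB⟩
        rw [hy, Finset.mem_singleton] at this
        exact hz.1 this
      · rw [Finset.card_erase_of_mem hym.1, hSc]; omega
    apply hcon' y hym.1 (by rw [hSeq]; exact hBr)
    rw [hSeq]
  · rintro ⟨_, hBc, _, _, hSc, hcnt⟩
    obtain ⟨x, hx⟩ := Finset.card_eq_one.1 hcnt
    have hxm : x ∈ (S \ B).filter (fun x => x ∈ M.closure (B : Set α)) := by rw [hx]; exact Finset.mem_singleton_self x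
    rw [Finset.mem_filter, Finset.mem_sdiff] at hxm
    have hxg : x ∈ gr M := hSg hxm.1.1
    have hCr : rkN M (insert x B) = q := by
      rw [(mem_closure_iff_rkN_insert hBg hxg).1 hxm.2, hBr]
    have hCc : (insert x B).card = q + 2 := by rw [Finset.card_insert_of_notMem hxm.1.2, hBc]
    have hCS : insert x B ⊆ S := Finset.insert_subset hxm.1.1 hBS
    have hcard : (S \ insert x B).card = 1 := by rw [Finset.card_sdiff_of_subset hCS, hSc, hCc]; omega
    obtain ⟨y, hy⟩ := Finset.card_eq_one.1 hcard
    have hym : y ∈ S \ insert x B := by rw [hy]; exact Finset.mem_singleton_self y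
    rw [Finset.mem_sdiff] at hym
    have hSeq : S.erase y = insert x B := by
      apply Finset.eq_of_subset_of_card_le
      · intro z hz
        rw [Finset.mem_erase] at hz
        by_contra hzC
        have : z ∈ S \ insert x B := Finset.mem_sdiff.2 ⟨hz.2, hzC⟩
        rw [hy, Finset.mem_singleton] at this
        exact hz.1 this
      · rw [Finset.card_erase_of_mem hym.1, hSc, hCc]; omega
    apply hcon' y hym.1 (by rw [hSeq]; exact hCr)
    rw [hSeq]; exact Finset.subset_insert x B

end GirthRows

end PercRepro
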